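import Summits.Ventures.QEC.Census.BB.A1s_n140_k12_0dfbc469.Data
import HarnessLib

/-!
# Census row `A1s_n140_k12_0dfbc469` — Brouwer–Zimmermann block verdicts 15…17 of the `Z` side (179130 codeword visits; fast twin `bzZBlockF`, `decide +kernel`, tier KERNEL). Part 2/2.
-/

set_option Elab.async false

namespace Summit.Ventures.QEC.Census.A1s_n140_k12_0dfbc469

/-- Block 15 of the `Z` side replays (59710 codeword visits; fast twin `bzZBlockF`, `decide +kernel`). -/
theorem blkZ_15 : A1s_n140_k12_0dfbc469.cert.bzZBlockF A1s_n140_k12_0dfbc469.bz 15 = true := by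
  decide +kernel

/-- Block 16 of the `Z` side replays (59710 codeword visits; fast twin `bzZBlockF`, `decide +kernel`). -/
theorem blkZ_16 : A1s_n140_k12_0dfbc469.cert.bzZBlockF A1s_n140_k12_0dfbc469.bz 16 = true := by
  decide +kernel

/-- Block 17 of the `Z` side replays (59710 codeword visits; fast twin `bzZBlockF`, `decide +kernel`). -/
theorem blkZ_17 : A1s_n140_k12_0dfbc469.cert.bzZBlockF A1s_n140_k12_0dfbc469.bz 17 = true := by
  decide +kernel

end Summit.Ventures.QEC.Census.A1s_n140_k12_0dfbc469
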